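import Literature.AlgebraicGeometry.HodgeTheory.AbelianVarietyPullbackQuadratic
import Literature.AlgebraicGeometry.HodgeTheory.WeilTypeOfQuaternionAction
import Literature.AlgebraicGeometry.Motives.PrymVariety
import HarnessLib

/-!
# WeilTypeLadder · quaternion symmetry of a polarization class, and the quaternion group on a Prym (helpers)

b2b cell `hweil` (packet `run/shared/lean/b2b/hodge-weil/`, CENSUS.md `## P3-g35`; prover 3). Helper file of
`Theorems/WeilTypeLadderQuaternionicPrym.lean` (van Geemen–Verra 2003: on a quaternionic Prym eightfold the Weil classes
are algebraic for EVERY quadratic `K ⊂ ℍ_ℚ`). Two self-contained pieces of algebra, all PROVED (no definition, no named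
fact, no `sorry`):

* §1 THE QUATERNION-SYMMETRY LEMMA. For endomorphisms `φ, χ` of a complex abelian variety `T` with `φ² = -a`, `χ² = -b`
  (`a, b ≥ 1`), `φχ = -χφ` — so the definite quaternion algebra `F = (-a,-b)_ℚ = ℚ⟨φ, χ⟩` acts — and a class
  `θ ∈ H²(T(ℂ); ℂ)` with `φ^*θ = a·θ`, `χ^*θ = b·θ`: the mixed term `B(φ,χ)θ = (φ+χ)^*θ - φ^*θ - χ^*θ` VANISHES
  (`cross_eq_zero_of_quaternionSymmetric`), hence `(φ+χ)^*θ = (a+b)θ` and, for EVERY element `x = pφ + qχ + rφχ` of the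
  order `ℤ⟨φ, χ⟩`, `x^*θ = (x x̄)·θ = (p²a + q²b + r²ab)·θ` (`map_pure_two_of_quaternionSymmetric`). This is van
  Geemen–Verra's defining condition of a polarized abelian variety of QUATERNION TYPE, "`x^*E = x x̄ E` [for all
  `x ∈ F`] … equivalent to the condition that the Rosati involution defined by `E` on `End(A)` induces the canonical
  involution on `F`" (Topology 42 (2003), 2.1), obtained here for the whole order from the two generators alone, on the
  tree's carriers, by the QUADRATIC CALCULUS of `f ↦ f^*θ` on `H² = ⋀²H¹` (`AbelianVarietyPullbackQuadratic`: the mixed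
  term is bilinear, `B(f≫α, g≫α)θ = B(f,g)(α^*θ)`) and WITHOUT the Riemann form or eigenbases: composing with `φ` gives
  `a·B(𝟙, φχ)θ = a·B(φ,χ)θ`, composing with `χ` gives `-b·B(𝟙, φχ)θ = b·B(φ,χ)θ`, so `2b·B(φ,χ)θ = 0`. (The tree's
  `cross_id_eq_zero_of_KSymmetric` is the commutative case `B(𝟙, φ)θ = 0`.) Also the `ℤ`-versions `map_zsmul_two`,
  `cross_zsmul_left`, `cross_zsmul_zsmul` of the calculus.
* §2 THE QUATERNION GROUP `Q = ⟨i, j | i⁴ = 1, j² = i², iji = j⟩` in a category (`j⁴ = 1`, `(ij)² = i²`, `(ij)⁴ = 1`),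
  and on the identity component `P = (ker(𝟙 + e))⁰` of an endomorphism `𝟙 + e` of an abelian variety `J`
  (`AbelianVariety.kerComponent`): `e` acts on `P` as `-𝟙`; an endomorphism `u` of `J` with `u² = e` restricts to `P`
  with square `-𝟙`; two such restrictions with `uvu = v` on `J` ANTICOMMUTE on `P`. For `J = J(C̃)`, `u = i_*`,
  `v = j_*` of a quaternionic cover this is `ℍ_ℤ = ℤ⟨i_P, j_P⟩ ⊂ End(P)`, `P = Prym(C̃/C̃⟨-1⟩)` (van Geemen–Verra
  Prop. 2.4–2.6).

HONEST LABEL: algebra only; nothing here is a case of HC, a rung or a DAG edge; 0 unconditional rungs added.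
-/

noncomputable section

-- every declaration of this problem lives in `Summit.HodgeConjecture.HodgeConjecture.…` (summit = sub-problem)
set_option linter.dupNamespace false

open CategoryTheory
open Literature.AlgebraicGeometry Literature.AlgebraicGeometry.Motives
open Literature.AlgebraicGeometry.HodgeTheory
open Literature.AlgebraicTopology.SingularHomology

namespace Summit.HodgeConjecture.HodgeConjecture.WeilTypeLadder

/-! ### §1 The quaternion-symmetry lemma: `x^*θ = (x x̄)·θ` on the whole order from the two generators -/

section QuaternionSymmetry

variable {T : Motives.AbelianVariety ℂ} {a b : ℕ} {φ χ : T ⟶ T}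

/-- The mixed term `B(f,g)θ := (f+g)^*θ - f^*θ - g^*θ` is symmetric: `B(f,g)θ = B(g,f)θ`. [folklore] -/
theorem cross_symm (f g : T ⟶ T) (θ : complexBetti T.X 2) :
    complexBetti.map (f + g).hom.hom.hom 2 θ - complexBetti.map f.hom.hom.hom 2 θ -
        complexBetti.map g.hom.hom.hom 2 θ =
      complexBetti.map (g + f).hom.hom.hom 2 θ - complexBetti.map g.hom.hom.hom 2 θ -
        complexBetti.map f.hom.hom.hom 2 θ := by
  rw [add_comm f g]; abel

/-- **The quaternion-symmetry lemma (cross term).** If `φ² = -a`, `χ² = -b` (`a, b ≥ 1`), `φχ = -χφ`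
— so `F = ℚ⟨φ, χ⟩ = (-a,-b)_ℚ` acts — and `θ ∈ H²` satisfies `φ^*θ = a·θ`, `χ^*θ = b·θ`, then the mixed term
`B(φ, χ)θ = (φ + χ)^*θ - φ^*θ - χ^*θ` VANISHES. This is the cohomological form of van Geemen–Verra's
"`x^*E = x x̄ E` for all `x ∈ F` ⟺ the Rosati involution induces the canonical involution of `F`" (2.1), here
derived for `x = φ + χ` from the two generators alone, by the quadratic calculus of `f ↦ f^*θ`
(`AbelianVarietyPullbackQuadratic`) and WITHOUT eigenbases or the Riemann form: composing with `φ`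
gives `a·B(𝟙, φχ)θ = a·B(φ,χ)θ`, composing with `χ` gives `-b·B(𝟙, φχ)θ = b·B(φ,χ)θ`, whence
`2b·B(φ,χ)θ = 0`. [cite: vanGeemenVerra2003QuaternionicPryms, 2.1 and proof of Prop. 2.4]
[cite: LangeBirkenhake1992, §5.1 (Rosati involution) and Lemma 2.4.5] -/
theorem cross_eq_zero_of_quaternionSymmetric (ha : 0 < a) (hb : 0 < b)
    (hφ : φ ≫ φ = -(a • 𝟙 T)) (hχ : χ ≫ χ = -(b • 𝟙 T)) (hφχ : φ ≫ χ = -(χ ≫ φ))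
    {θ : complexBetti T.X 2}
    (hθφ : complexBetti.map φ.hom.hom.hom 2 θ = (a : ℂ) • θ)
    (hθχ : complexBetti.map χ.hom.hom.hom 2 θ = (b : ℂ) • θ) :
    complexBetti.map (φ + χ).hom.hom.hom 2 θ - complexBetti.map φ.hom.hom.hom 2 θ -
      complexBetti.map χ.hom.hom.hom 2 θ = 0 := by
  have hid : complexBetti.map (𝟙 T : T ⟶ T).hom.hom.hom 2 θ = θ := abelianVariety_map_id_apply θ
  have hχφ : χ ≫ φ = -(φ ≫ χ) := comp_eq_neg_comp_of_anticomm hφχ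
  set x := complexBetti.map (φ + χ).hom.hom.hom 2 θ - complexBetti.map φ.hom.hom.hom 2 θ -
      complexBetti.map χ.hom.hom.hom 2 θ with hx
  set y := complexBetti.map (𝟙 T + φ ≫ χ).hom.hom.hom 2 θ - θ -
      complexBetti.map (φ ≫ χ).hom.hom.hom 2 θ with hy
  -- Step 1: compose with `φ` on the right: `a • y = a • x`
  have h1 := cross_comp_right φ χ φ θ
  rw [hθφ, map_smul, map_smul, map_smul, hφ, hχφ, ← neg_add, map_neg_two, map_neg_two,
    map_neg_two, cross_nsmul_left a (𝟙 T) (φ ≫ χ) θ, hid] at h1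
  have h1' : (a : ℂ) • y = (a : ℂ) • x := by
    simp only [hy, hx, smul_sub] at h1 ⊢
    exact h1
  have ha0 : (a : ℂ) ≠ 0 := by exact_mod_cast ha.ne'
  have hyx : y = x := smul_right_injective _ ha0 h1'
  -- Step 2: compose with `χ` on the right: `-(b • y) = b • x`
  have h2 := cross_comp_right φ χ χ θ
  rw [hθχ, map_smul, map_smul, map_smul, hχ] at h2
  have h2' : complexBetti.map (φ ≫ χ + -(b • 𝟙 T)).hom.hom.hom 2 θ -
        complexBetti.map (φ ≫ χ).hom.hom.hom 2 θ - complexBetti.map (-(b • 𝟙 T)).hom.hom.hom 2 θ =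
      complexBetti.map (-(b • 𝟙 T) + φ ≫ χ).hom.hom.hom 2 θ -
        complexBetti.map (-(b • 𝟙 T)).hom.hom.hom 2 θ - complexBetti.map (φ ≫ χ).hom.hom.hom 2 θ := by
    rw [add_comm]; abel
  rw [h2', cross_neg_left (b • 𝟙 T) (φ ≫ χ) θ, cross_nsmul_left b (𝟙 T) (φ ≫ χ) θ, hid] at h2
  have h2'' : -((b : ℂ) • y) = (b : ℂ) • x := by
    simp only [hy, hx, smul_sub] at h2 ⊢
    exact h2
  rw [hyx] at h2''
  -- `2b • x = 0`
  have h3 : ((2 : ℂ) * b) • x = 0 := by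
    rw [mul_smul, two_smul]
    nth_rewrite 1 [← h2'']
    exact neg_add_cancel _
  have hb0 : ((2 : ℂ) * b) ≠ 0 := mul_ne_zero two_ne_zero (by exact_mod_cast hb.ne')
  exact (smul_eq_zero.mp h3).resolve_left hb0

/-- **`(φ + χ)^*θ = (a + b)·θ`** under the hypotheses of `cross_eq_zero_of_quaternionSymmetric`
(`x^*E = x x̄ E` for `x = φ + χ`, `x x̄ = a + b`). [cite: vanGeemenVerra2003QuaternionicPryms, 2.1] -/
theorem map_add_two_of_quaternionSymmetric (ha : 0 < a) (hb : 0 < b)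
    (hφ : φ ≫ φ = -(a • 𝟙 T)) (hχ : χ ≫ χ = -(b • 𝟙 T)) (hφχ : φ ≫ χ = -(χ ≫ φ))
    {θ : complexBetti T.X 2}
    (hθφ : complexBetti.map φ.hom.hom.hom 2 θ = (a : ℂ) • θ)
    (hθχ : complexBetti.map χ.hom.hom.hom 2 θ = (b : ℂ) • θ) :
    complexBetti.map (φ + χ).hom.hom.hom 2 θ = ((a : ℂ) + (b : ℂ)) • θ := by
  have h := cross_eq_zero_of_quaternionSymmetric ha hb hφ hχ hφχ hθφ hθχ
  rw [sub_sub, sub_eq_zero, hθφ, hθχ, ← add_smul] at h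
  exact h

/-- `(z • f)^*θ = z²·f^*θ` on `H²` for an INTEGER `z` (from the `ℕ`-case `map_nsmul_two` and
`(-f)^* = f^*` on `H²`, `map_neg_two`). [cite: LangeBirkenhake1992, 1.1.2 and Lemma 1.1.17] -/
theorem map_zsmul_two (z : ℤ) (f : T ⟶ T) (θ : complexBetti T.X 2) :
    complexBetti.map (z • f).hom.hom.hom 2 θ = ((z : ℂ) ^ 2) • complexBetti.map f.hom.hom.hom 2 θ := by
  rcases Int.eq_nat_or_neg z with ⟨n, rfl | rfl⟩
  · rw [natCast_zsmul, map_nsmul_two, Int.cast_natCast]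
  · rw [neg_smul, natCast_zsmul, map_neg_two, map_nsmul_two, Int.cast_neg, Int.cast_natCast, neg_sq]

/-- The mixed term is `ℤ`-homogeneous in its first argument: `B(z·f, g)θ = z·B(f,g)θ`.
[cite: LangeBirkenhake1992, 1.1.2 and Lemma 1.1.17] -/
theorem cross_zsmul_left (z : ℤ) (f g : T ⟶ T) (θ : complexBetti T.X 2) :
    complexBetti.map (z • f + g).hom.hom.hom 2 θ - complexBetti.map (z • f).hom.hom.hom 2 θ -
        complexBetti.map g.hom.hom.hom 2 θ =
      (z : ℂ) • (complexBetti.map (f + g).hom.hom.hom 2 θ - complexBetti.map f.hom.hom.hom 2 θ -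
        complexBetti.map g.hom.hom.hom 2 θ) := by
  rcases Int.eq_nat_or_neg z with ⟨n, rfl | rfl⟩
  · rw [natCast_zsmul, cross_nsmul_left, Int.cast_natCast]
  · rw [neg_smul, natCast_zsmul, cross_neg_left, cross_nsmul_left, Int.cast_neg, Int.cast_natCast,
      neg_smul]

/-- The mixed term is `ℤ`-bilinear: `B(z·f, w·g)θ = (z w)·B(f,g)θ`. [cite: LangeBirkenhake1992, 1.1.2 and Lemma 1.1.17] -/
theorem cross_zsmul_zsmul (z w : ℤ) (f g : T ⟶ T) (θ : complexBetti T.X 2) :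
    complexBetti.map (z • f + w • g).hom.hom.hom 2 θ - complexBetti.map (z • f).hom.hom.hom 2 θ -
        complexBetti.map (w • g).hom.hom.hom 2 θ =
      ((z : ℂ) * (w : ℂ)) • (complexBetti.map (f + g).hom.hom.hom 2 θ -
        complexBetti.map f.hom.hom.hom 2 θ - complexBetti.map g.hom.hom.hom 2 θ) := by
  rw [cross_zsmul_left, cross_symm f (w • g), cross_zsmul_left, cross_symm g f, smul_smul]

/-- **`x^*θ = (x x̄)·θ` for every element `x = p·φ + q·χ + r·φχ` of the order `ℤ⟨φ, χ⟩`** of the definite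
quaternion algebra `(-a,-b)_ℚ ⊂ End⁰(T)` (`x x̄ = p²a + q²b + r²ab`), granted only the two generator
symmetries `φ^*θ = a·θ`, `χ^*θ = b·θ`: the polarization class `θ` is of quaternion type for the whole order
(van Geemen–Verra 2.1: "`x^*E = x x̄ E` … equivalent to the condition that the Rosati involution defined by `E`
… induces the canonical involution on `F`"). Proof: expand by the quadratic calculus; the three mixed terms
`B(φ,χ)θ`, `B(φ,φχ)θ`, `B(χ,φχ)θ` vanish by `cross_eq_zero_of_quaternionSymmetric` (the pairs anticommute and
`(φχ)^*θ = ab·θ`). [cite: vanGeemenVerra2003QuaternionicPryms, 2.1 and Prop. 2.4] -/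
theorem map_pure_two_of_quaternionSymmetric (ha : 0 < a) (hb : 0 < b)
    (hφ : φ ≫ φ = -(a • 𝟙 T)) (hχ : χ ≫ χ = -(b • 𝟙 T)) (hφχ : φ ≫ χ = -(χ ≫ φ))
    {θ : complexBetti T.X 2}
    (hθφ : complexBetti.map φ.hom.hom.hom 2 θ = (a : ℂ) • θ)
    (hθχ : complexBetti.map χ.hom.hom.hom 2 θ = (b : ℂ) • θ) (p q r : ℤ) :
    complexBetti.map (p • φ + q • χ + r • (φ ≫ χ)).hom.hom.hom 2 θ =
      (((p ^ 2 * a + q ^ 2 * b + r ^ 2 * (a * b) : ℤ)) : ℂ) • θ := by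
  -- the third generator `ψ = φχ`: `ψ² = -ab`, anticommutes with `φ` and `χ`, `ψ^*θ = ab·θ`
  have hψ : (φ ≫ χ) ≫ (φ ≫ χ) = -((a * b) • 𝟙 T) := comp_comp_self_of_anticomm hφ hχ hφχ
  have hφψ : φ ≫ (φ ≫ χ) = -((φ ≫ χ) ≫ φ) := anticomm_comp_of_anticomm hφχ
  have hχψ : χ ≫ (φ ≫ χ) = -((φ ≫ χ) ≫ χ) := by
    rw [← Category.assoc, comp_eq_neg_comp_of_anticomm hφχ, Preadditive.neg_comp, Category.assoc]
  have hθψ : complexBetti.map (φ ≫ χ).hom.hom.hom 2 θ = ((a * b : ℕ) : ℂ) • θ := by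
    rw [← complexBetti_map_map_hom, hθχ, map_smul, hθφ, smul_smul, Nat.cast_mul, mul_comm]
  have hab : 0 < a * b := Nat.mul_pos ha hb
  -- the three vanishing mixed terms
  have B1 := cross_eq_zero_of_quaternionSymmetric ha hb hφ hχ hφχ hθφ hθχ
  have B2 := cross_eq_zero_of_quaternionSymmetric ha hab hφ hψ hφψ hθφ hθψ
  have B3 := cross_eq_zero_of_quaternionSymmetric hb hab hχ hψ hχψ hθχ hθψ
  -- expand `(pφ + qχ) + rψ`
  have E1 := cross_zsmul_zsmul p q φ χ θ
  rw [B1, smul_zero, sub_sub, sub_eq_zero, map_zsmul_two, map_zsmul_two, hθφ, hθχ] at E1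
  -- E1 : pb (p•φ + q•χ) θ = p² • a • θ + q² • b • θ
  have E2 := cross_add_left (p • φ) (q • χ) (r • (φ ≫ χ)) θ
  rw [cross_zsmul_zsmul p r φ (φ ≫ χ) θ, cross_zsmul_zsmul q r χ (φ ≫ χ) θ, B2, B3, smul_zero,
    smul_zero, add_zero, sub_sub, sub_eq_zero, E1, map_zsmul_two, hθψ] at E2
  rw [E2]
  simp only [smul_smul, ← add_smul]
  congr 1
  push_cast
  ring

end QuaternionSymmetry

/-! ### §2 The quaternion group on the curve, on the Jacobian, and on the Prym `P = (ker(𝟙 + (ι²)_*))⁰` -/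

section QuaternionGroup

variable {𝒞 : Type*} [Category 𝒞] {X : 𝒞} {ι j : X ⟶ X}

/-- `j⁴ = 𝟙` from `ι⁴ = 𝟙` and `j² = ι²` (the relations of `Q = ⟨i, j | i⁴ = 1, j² = i², iji = j⟩`). [folklore] -/
theorem quaternion_j_pow_four (hι : ι ≫ ι ≫ ι ≫ ι = 𝟙 X) (hj : j ≫ j = ι ≫ ι) :
    j ≫ j ≫ j ≫ j = 𝟙 X := by
  calc j ≫ j ≫ j ≫ j = (j ≫ j) ≫ (j ≫ j) := by simp only [Category.assoc]
    _ = (ι ≫ ι) ≫ (ι ≫ ι) := by rw [hj]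
    _ = 𝟙 X := by simpa only [Category.assoc] using hι

/-- `(ιj)² = ι²` from `iji = j` and `j² = i²` (`k² = -1 = i²` in `Q`). [folklore] -/
theorem quaternion_k_sq (hj : j ≫ j = ι ≫ ι) (hq : ι ≫ j ≫ ι = j) :
    (ι ≫ j) ≫ (ι ≫ j) = ι ≫ ι := by
  calc (ι ≫ j) ≫ (ι ≫ j) = (ι ≫ j ≫ ι) ≫ j := by simp only [Category.assoc]
    _ = j ≫ j := by rw [hq]
    _ = ι ≫ ι := hj

/-- `(ιj)⁴ = 𝟙` (`k` has order `4` in `Q`). [folklore] -/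
theorem quaternion_k_pow_four (hι : ι ≫ ι ≫ ι ≫ ι = 𝟙 X) (hj : j ≫ j = ι ≫ ι) (hq : ι ≫ j ≫ ι = j) :
    (ι ≫ j) ≫ (ι ≫ j) ≫ (ι ≫ j) ≫ (ι ≫ j) = 𝟙 X := by
  calc (ι ≫ j) ≫ (ι ≫ j) ≫ (ι ≫ j) ≫ (ι ≫ j) = ((ι ≫ j) ≫ (ι ≫ j)) ≫ ((ι ≫ j) ≫ (ι ≫ j)) := by
        simp only [Category.assoc]
    _ = (ι ≫ ι) ≫ (ι ≫ ι) := by rw [quaternion_k_sq hj hq]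
    _ = 𝟙 X := by simpa only [Category.assoc] using hι

end QuaternionGroup

section PrymEndomorphisms

variable {J : Motives.AbelianVariety ℂ} {e u v : J ⟶ J}
  {uP vP : AbelianVariety.kerComponent (𝟙 J + e) ⟶ AbelianVariety.kerComponent (𝟙 J + e)}

/-- **On `P = (ker(𝟙 + e))⁰` the endomorphism `e` acts as `-𝟙`**: `ι_P ≫ e = -ι_P` for the inclusion `ι_P`
(`(ker φ)⁰ ↪ X` is killed by `φ = 𝟙 + e`, `AbelianVariety.kerComponentι_comp`). [folklore] -/
theorem kerComponentι_comp_eq_neg :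
    AbelianVariety.kerComponentι (𝟙 J + e) ≫ e = -AbelianVariety.kerComponentι (𝟙 J + e) := by
  have h0 := AbelianVariety.kerComponentι_comp (𝟙 J + e)
  rw [Preadditive.comp_add, Category.comp_id] at h0
  exact eq_neg_of_add_eq_zero_right h0

/-- **An endomorphism `u` of `J` with `u² = e` restricts to `P = (ker(𝟙 + e))⁰` with square `-𝟙`** (for `u = α_*`,
`α` of order `4` acting freely on the curve: the primitive Prym `B_prim = (ker Φ₄(α_*))⁰` carries `ℤ[α_B] = ℤ[i]`;
Schoen 1988 §3, Patel–Zhang 2025 §5.1 at `m = 4`). [cite: PatelZhang2025PrymHodge, §5.1] -/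
theorem kerComponent_restrict_comp_self_eq_neg_id (hu : u ≫ u = e)
    (huP : uP ≫ AbelianVariety.kerComponentι (𝟙 J + e) = AbelianVariety.kerComponentι (𝟙 J + e) ≫ u) :
    uP ≫ uP = -𝟙 _ := by
  rw [← cancel_mono (AbelianVariety.kerComponentι (𝟙 J + e)), Category.assoc, huP, ← Category.assoc, huP,
    Category.assoc, hu, kerComponentι_comp_eq_neg, Preadditive.neg_comp, Category.id_comp]

/-- **Two such restrictions ANTICOMMUTE when `u v u = v` on `J`**: `u_P v_P = -v_P u_P` (for `u = i_*`, `v = j_*` of a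
quaternionic cover: `iji = j` in `Q`, so `ℤ⟨i_P, j_P⟩ = ℍ_ℤ ⊂ End(P)`, van Geemen–Verra 2003 Prop. 2.4 / 2.5).
[cite: vanGeemenVerra2003QuaternionicPryms, Prop. 2.4 and 2.5] -/
theorem kerComponent_restrict_anticomm (hu : u ≫ u = e) (huvu : u ≫ v ≫ u = v)
    (huP : uP ≫ AbelianVariety.kerComponentι (𝟙 J + e) = AbelianVariety.kerComponentι (𝟙 J + e) ≫ u)
    (hvP : vP ≫ AbelianVariety.kerComponentι (𝟙 J + e) = AbelianVariety.kerComponentι (𝟙 J + e) ≫ v) :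
    uP ≫ vP = -(vP ≫ uP) := by
  have h1 : uP ≫ vP ≫ uP = vP := by
    rw [← cancel_mono (AbelianVariety.kerComponentι (𝟙 J + e)), Category.assoc, Category.assoc, huP,
      ← Category.assoc vP, hvP, Category.assoc, ← Category.assoc uP, huP, Category.assoc, huvu]
  have h2 := congrArg (· ≫ uP) h1
  simp only [Category.assoc, kerComponent_restrict_comp_self_eq_neg_id hu huP, Preadditive.comp_neg,
    Category.comp_id] at h2
  rw [← h2, neg_neg]

end PrymEndomorphisms



end Summit.HodgeConjecture.HodgeConjecture.WeilTypeLadder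

end
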